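import Summits.CriticalPhenomena.PercolationContinuityZ3.Theorems.PercNearOneGluingNoHeavyLowerTailSahiHalfCoSingletonChains
import Mathlib.Tactic.Linarith
import Mathlib.Tactic.Ring
import HarnessLib

/-!
# `NoHeavyLowerTail` (stmt-CriticalPhenomena-4575) — the co-singleton split of the cube, and the `E₂` row: `Cov(f,g) ≥ q_j(1−q_j)·μ(j pivotal for f and g)`

Support file, seat `prim-l12-p5` (gen 2), `--supports stmt-CriticalPhenomena-4575`.  No definitions, no named facts, no sorries.

* `sum_eq_sum_hi_add_sum_lo` — FUBINI for the co-singleton split: `Σ_x F(x) = Σ_v F(hi j v) + Σ_v F(lo j v)` (every configuration is the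
  `x_j = 1` or the `x_j = 0` extension of its restriction to the other coordinates);
* `ex_eq_hi_lo` — hence `E F = q_j·Σ_v w(v) F(hi j v) + (1−q_j)·Σ_v w(v) F(lo j v)` for the product weight;
* **`coinfluence_le_sahiE_two`** — the `E₂` row of the conditioning hierarchy (P5-REPORT §3h(a)(v)): for monotone `{0,1}`-valued `f, g`,
  every product weight and EVERY coordinate `j`,
  `q_j(1−q_j) · Σ_v w(v)·(f(hi)−f(lo))(g(hi)−g(lo)) ≤ E₂(f,g) = Cov(f,g)`,
  i.e. the covariance dominates the (variance-normalised) JOINT INFLUENCE of every single coordinate — the law of total covariance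
  `Cov(f,g) = q_j(1−q_j)·E[π_f π_g] + Cov(E[f | x_{−j}], E[g | x_{−j}])` plus Harris for the conditional expectations on the cube of the
  other coordinates.  This is the theorem whose `E₃`-analogues are the lane's conjectures: for `E₃` the every-`j` form with constant `1`
  (co-singleton bound) is FALSE, the `∃ j` form (`CoSingletonBound`) and the every-`j` form with constant `½` (`HalfCoSingletonBound`)
  are open, the latter proved for two equal slots (`…SahiHalfCoSingletonTwoEqual`).
-/

namespace Summit.CriticalPhenomena.PercolationContinuityZ3.Theorems

namespace SahiCoSingleton

open Finset Literature.Combinatorics.Sahi2008 SahiSubsetChord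

variable {ι : Type*} [Fintype ι] [DecidableEq ι]

/-- A configuration with `x_j = true` is the `hi`-extension of its restriction. [this file] -/
theorem hi_restrict_eq (j : ι) (x : ι → Bool) (hx : x j = true) :
    hi j (fun i : {i // i ∈ (univ : Finset ι).erase j} => x i) = x := by
  funext i
  unfold hi glue
  split_ifs with h
  · rfl
  · have hij : i = j := by
      by_contra hne
      exact h (Finset.mem_erase.mpr ⟨hne, Finset.mem_univ i⟩)
    have hxi : x i = true := by rw [hij]; exact hx
    simp only [hxi]

/-- A configuration with `x_j = false` is the `lo`-extension of its restriction. [this file] -/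
theorem lo_restrict_eq (j : ι) (x : ι → Bool) (hx : x j = false) :
    lo j (fun i : {i // i ∈ (univ : Finset ι).erase j} => x i) = x := by
  funext i
  unfold lo glue
  split_ifs with h
  · rfl
  · have hij : i = j := by
      by_contra hne
      exact h (Finset.mem_erase.mpr ⟨hne, Finset.mem_univ i⟩)
    have hxi : x i = false := by rw [hij]; exact hx
    simp only [hxi]

/-- **Fubini for the co-singleton split**: `Σ_x F(x) = Σ_v F(hi j v) + Σ_v F(lo j v)`. [this file] -/
theorem sum_eq_sum_hi_add_sum_lo (j : ι) (F : (ι → Bool) → ℝ) :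
    ∑ x, F x = ∑ v : ({i // i ∈ (univ : Finset ι).erase j} → Bool), F (hi j v)
      + ∑ v : ({i // i ∈ (univ : Finset ι).erase j} → Bool), F (lo j v) := by
  classical
  have hdisj : Disjoint ((univ : Finset ({i // i ∈ (univ : Finset ι).erase j} → Bool)).image (hi j))
      ((univ : Finset ({i // i ∈ (univ : Finset ι).erase j} → Bool)).image (lo j)) := by
    rw [Finset.disjoint_left]
    intro x hxh hxl
    obtain ⟨v, -, rfl⟩ := Finset.mem_image.mp hxh
    obtain ⟨v', -, hv'⟩ := Finset.mem_image.mp hxl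
    have h1 := congrArg (fun y => y j) hv'
    simp only [hi_apply_self, lo_apply_self] at h1
    exact Bool.false_ne_true h1
  have hcover : (univ : Finset (ι → Bool)) =
      (univ : Finset ({i // i ∈ (univ : Finset ι).erase j} → Bool)).image (hi j)
        ∪ (univ : Finset ({i // i ∈ (univ : Finset ι).erase j} → Bool)).image (lo j) := by
    ext x
    simp only [Finset.mem_univ, Finset.mem_union, Finset.mem_image, true_and, true_iff]
    cases hx : x j
    · exact Or.inr ⟨fun i => x i, lo_restrict_eq j x hx⟩
    · exact Or.inl ⟨fun i => x i, hi_restrict_eq j x hx⟩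
  rw [show (∑ x, F x) = ∑ x ∈ (univ : Finset (ι → Bool)), F x from rfl, hcover, Finset.sum_union hdisj,
    Finset.sum_image (fun v _ v' _ h => hi_injective j h), Finset.sum_image (fun v _ v' _ h => lo_injective j h)]

/-- The expectation under a product weight splits along coordinate `j` with weights `q_j`, `1 − q_j`. [this file] -/
theorem ex_eq_hi_lo (q : ι → ℝ) (j : ι) (F : (ι → Bool) → ℝ) :
    ex (prodWeight q) F
      = q j * ∑ v : ({i // i ∈ (univ : Finset ι).erase j} → Bool),
          prodWeight (fun i : {i // i ∈ (univ : Finset ι).erase j} => q i) v * F (hi j v)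
        + (1 - q j) * ∑ v : ({i // i ∈ (univ : Finset ι).erase j} → Bool),
          prodWeight (fun i : {i // i ∈ (univ : Finset ι).erase j} => q i) v * F (lo j v) := by
  unfold ex
  rw [sum_eq_sum_hi_add_sum_lo j, Finset.mul_sum, Finset.mul_sum]
  congr 1
  · refine Finset.sum_congr rfl fun v _ => ?_
    rw [prodWeight_hi]; ring
  · refine Finset.sum_congr rfl fun v _ => ?_
    rw [prodWeight_lo]; ring

/-- **The `E₂` row: the covariance dominates the joint influence of every coordinate.**  For monotone nonnegative `f, g` on the cube
with a product weight and every `j`: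
`q_j(1−q_j)·Σ_v w(v)(f(hi j v) − f(lo j v))(g(hi j v) − g(lo j v)) ≤ E₂(f,g)` (law of total covariance + Harris on the other
coordinates). [this file] -/
theorem coinfluence_le_sahiE_two (q : ι → ℝ) (hq : ∀ i, 0 ≤ q i ∧ q i ≤ 1) (f g : (ι → Bool) → ℝ)
    (hf0 : ∀ x, 0 ≤ f x) (hg0 : ∀ x, 0 ≤ g x) (hfm : Monotone f) (hgm : Monotone g) (j : ι) :
    q j * (1 - q j) * ∑ v : ({i // i ∈ (univ : Finset ι).erase j} → Bool),
        prodWeight (fun i : {i // i ∈ (univ : Finset ι).erase j} => q i) v *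
          ((f (hi j v) - f (lo j v)) * (g (hi j v) - g (lo j v)))
      ≤ sahiE (prodWeight q) 2 ![f, g] := by
  set s := q j with hs
  have hs0 : 0 ≤ s := (hq j).1
  have hs1 : s ≤ 1 := (hq j).2
  set w : ({i // i ∈ (univ : Finset ι).erase j} → Bool) → ℝ :=
    prodWeight (fun i : {i // i ∈ (univ : Finset ι).erase j} => q i) with hw
  have hFKG : IsFKGMeasure w := isFKGMeasure_coinWeight (fun i => hq i)
  have hsum1 : ∑ v, w v = 1 := sum_coinWeight _
  -- the averaged sections
  set fb : ({i // i ∈ (univ : Finset ι).erase j} → Bool) → ℝ := fun v => s * f (hi j v) + (1 - s) * f (lo j v) with hfb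
  set gb : ({i // i ∈ (univ : Finset ι).erase j} → Bool) → ℝ := fun v => s * g (hi j v) + (1 - s) * g (lo j v) with hgb
  have hfb0 : ∀ v, 0 ≤ fb v := fun v => by
    simp only [hfb]; nlinarith [hf0 (hi j v), hf0 (lo j v), hs0, hs1]
  have hgb0 : ∀ v, 0 ≤ gb v := fun v => by
    simp only [hgb]; nlinarith [hg0 (hi j v), hg0 (lo j v), hs0, hs1]
  have hfbm : Monotone fb := by
    intro v v' hvv'
    simp only [hfb]
    have h1 := hfm (hi_mono j hvv'); have h2 := hfm (lo_mono j hvv')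
    nlinarith [h1, h2, hs0, hs1]
  have hgbm : Monotone gb := by
    intro v v' hvv'
    simp only [hgb]
    have h1 := hgm (hi_mono j hvv'); have h2 := hgm (lo_mono j hvv')
    nlinarith [h1, h2, hs0, hs1]
  have harris := ex_mul_ex_le_ex_mul hFKG hfb0 hgb0 hfbm hgbm
  unfold ex at harris
  -- rewrite the three expectations through the split
  rw [sahiE_two]
  have eF : ex (prodWeight q) f = ∑ v, w v * fb v := by
    rw [ex_eq_hi_lo q j f, Finset.mul_sum, Finset.mul_sum, ← Finset.sum_add_distrib]
    refine Finset.sum_congr rfl fun v _ => ?_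
    simp only [hfb]; ring
  have eG : ex (prodWeight q) g = ∑ v, w v * gb v := by
    rw [ex_eq_hi_lo q j g, Finset.mul_sum, Finset.mul_sum, ← Finset.sum_add_distrib]
    refine Finset.sum_congr rfl fun v _ => ?_
    simp only [hgb]; ring
  have eFG : ex (prodWeight q) (f * g)
      = ∑ v, w v * (fb v * gb v)
        + s * (1 - s) * ∑ v, w v * ((f (hi j v) - f (lo j v)) * (g (hi j v) - g (lo j v))) := by
    rw [ex_eq_hi_lo q j (f * g), Finset.mul_sum, Finset.mul_sum, Finset.mul_sum, ← Finset.sum_add_distrib,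
      ← Finset.sum_add_distrib]
    refine Finset.sum_congr rfl fun v _ => ?_
    simp only [hfb, hgb, Pi.mul_apply]; ring
  rw [eF, eG, eFG]
  have key : (∑ v, w v * fb v) * (∑ v, w v * gb v) ≤ ∑ v, w v * (fb v * gb v) := by
    simpa [Pi.mul_apply] using harris
  linarith [key]

end SahiCoSingleton

end Summit.CriticalPhenomena.PercolationContinuityZ3.Theorems
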